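import Summits.FinalStateConjecture.FinalStateConjecture.Theorems.EIHFluxBalanceInertialRecessionStubRechart3OtherHoles

/-!
# Route EIHFluxBalance — `InertialRecession`, re-charting: near-zone convergence of the clock chart

Helper file for the crux `stmt-FinalStateConjecture-10166`
(`Summit.FinalStateConjecture.FinalStateConjecture.Theses.EIHFluxBalance.InertialRecession`),
line `sublinear-is-free-clean-window-charges`, stub `stub_rechart` (the transfer P2), part G1.

`tendsto_truncDeviationCk_clockChart` — **near-zone `C²` convergence of the rest-frame clock chart,
for every fixed radius `R`**, for general (wandering, rotating) painted frames and every spin: the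
rest-frame hole chart `Ψ₁ = Φ ∘ A` (with `A` equal to the honest chart `ψ` of the normalised frame
`Λ̃ᵢ` and the clock `T₀` near every late point of bounded spatial offset) satisfies
`truncDeviationCk (boostedKerrBackground 1 0 Mᵢ aᵢ) Ψ₁ 2 R τ → 0`.
Inputs: the slab-point bound (`…Window`), late windows of the frame/centre data (`exists_window`),
the lab `C³` deviation decay of the crux hypothesis (pointwise via `enorm_iteratedFDeriv_le_supCkENorm`),
the other holes (`eventually_otherHole_small`), uniform Kerr bounds (`exists_bound_iteratedFDeriv_kerr`).
The final boost is added afterwards by `tendsto_truncDeviationCk_boostTransport` (`…BoostTransport`).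
[folklore]
-/

noncomputable section

set_option linter.dupNamespace false

open Set Filter Function Metric Topology TopologicalSpace
open scoped ContDiff Manifold ENNReal BigOperators
open Literature.Geometry.Lorentzian

namespace Summit.FinalStateConjecture.FinalStateConjecture.Theorems.SublinearIsFree.Rechart

/-- Slab geometry: on the rest exterior, `r ≤ R` forces `‖ỹ‖ ≤ max R 0 + |a|`. [folklore] -/
theorem norm_spatial_le_of_radius_le (a : ℝ) {R : ℝ} (y : E4) (hyR : Kerr.radius a y ≤ R) :
    ‖E4.spatial y‖ ≤ max R 0 + |a| := by
  have h := Theorems.SwallowTheDatum.KerrShieldedSettles.KerrLeafSojourn.spatialNorm_sub_le_radius a y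
  have h2 : Kerr.radius a y ≤ max R 0 := hyR.trans (le_max_left _ _)
  change ‖E4.spatial y‖ - |a| ≤ _ at h
  linarith

-- long chain of bookkeeping (filters, constants, and the slab-point bound)
set_option maxHeartbeats 1600000 in
/-- **Near-zone `C²` convergence of the rest-frame clock chart (fixed radius).** See the module
docstring. [folklore] -/
theorem tendsto_truncDeviationCk_clockChart
    (𝓢 : Spacetime 4) {N : ℕ} (i : Fin N) (M a : Fin N → ℝ) (Λ : Fin N → ℝ → lorentzGroup)
    (ξ : Fin N → ℝ → E3) (Λt : Fin N → ℝ → lorentzGroup) (T₀ : ℝ → ℝ)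
    (hbil : ∀ j t x, boostedKerrBilin (Λt j t) (E4.ofTimeSpace t (ξ j t)) (M j) (a j) x =
      boostedKerrBilin (Λ j t) (E4.ofTimeSpace t (ξ j t)) (M j) (a j) x)
    (hrad : ∀ j t x, Kerr.radius (a j) (poincareInv (Λt j t) (E4.ofTimeSpace t (ξ j t)) x) =
      Kerr.radius (a j) (poincareInv (Λ j t) (E4.ofTimeSpace t (ξ j t)) x))
    {H : Fin N → E4 → E4 →L[ℝ] E4 →L[ℝ] ℝ}
    (hH : ∀ j z, H j z = boostedKerrBilin (Λ j (z 0)) (E4.ofTimeSpace (z 0) (ξ j (z 0))) (M j) (a j) z -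
      Minkowski.bilin)
    {Bb : E4 → E4 →L[ℝ] E4 →L[ℝ] ℝ} (hBb : ∀ z, Bb z = Minkowski.bilin + ∑ j, H j z)
    (hΛ : ∀ j, ContDiff ℝ ∞ (fun t ↦ ((Λ j t : E4 ≃L[ℝ] E4) : E4 →L[ℝ] E4)))
    (hξ : ∀ j, ContDiff ℝ ∞ (ξ j))
    (hΛt : ∀ j, ContDiff ℝ ∞ (fun t ↦ ((Λt j t : E4 ≃L[ℝ] E4) : E4 →L[ℝ] E4)))
    (hdec : ∀ j m, 1 ≤ m → m ≤ 3 → Tendsto (fun t ↦ iteratedDeriv m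
      (fun s ↦ ((Λt j s : E4 ≃L[ℝ] E4) : E4 →L[ℝ] E4)) t) atTop (𝓝 0))
    {γ : ℝ} (hγ1 : 1 ≤ γ) (huγ : ∀ j t, |((Λt j t : E4 ≃L[ℝ] E4) (E4.basisVector 0)) 0| ≤ γ)
    (hpos : ∀ j t, 0 < ((Λt j t : E4 ≃L[ℝ] E4) (E4.basisVector 0)) 0)
    (hmis : ∀ j, ∀ m : ℕ, m ≤ 2 → Tendsto (fun t ↦ iteratedDeriv m (fun s ↦ deriv (ξ j) s -
      ((((Λt j s : E4 ≃L[ℝ] E4) (E4.basisVector 0)) 0)⁻¹ •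
        E4.spatial ((Λt j s : E4 ≃L[ℝ] E4) (E4.basisVector 0)))) t) atTop (𝓝 0))
    (hsep : ∀ j ≠ i, Tendsto (fun t ↦ ‖ξ i t - ξ j t‖) atTop atTop)
    (hT₀ : ContDiff ℝ ∞ T₀) (hclock : ∀ τ, HasDerivAt T₀ (frameVel (Λt i (T₀ τ)) 0) τ)
    (hT₀inf : Tendsto T₀ atTop atTop)
    (U : Opens E4) (Φ : U → 𝓢.carrier) (hΦ : ContMDiff 𝓘(ℝ, E4) (𝓡 4) ∞ Φ)
    (hdev : Tendsto (fun t ↦ 𝓢.deviationCk ⟨U, Bb, fun z ↦ z 0, E4.spatialNorm⟩ Φ 3 t) atTop (𝓝 0))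
    {A : E4 → E4} (hAc : ContDiff ℝ ∞ A) (hAU : ∀ y ∈ boostedKerrExterior 1 0 (M i) (a i), A y ∈ U)
    {Ψ₁ : boostedKerrExterior 1 0 (M i) (a i) → 𝓢.carrier} (hΨ₁ : ∀ y, Ψ₁ y = Φ ⟨A y.1, hAU y.1 y.2⟩)
    (hhon : ∀ K : ℝ, ∃ τK : ℝ, ∀ y : E4, τK ≤ y 0 → ‖E4.spatial y‖ ≤ K →
      A =ᶠ[𝓝 y] honestChart (Λt i) (ξ i) T₀)
    (hrPlus : 0 < Kerr.rPlus (M i) (a i)) (R : ℝ) :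
    Tendsto (fun τ ↦ 𝓢.truncDeviationCk (boostedKerrBackground 1 0 (M i) (a i)) Ψ₁ 2 R τ) atTop (𝓝 0) := by
  set Bf : ModelBackground := ⟨U, Bb, fun z ↦ z 0, E4.spatialNorm⟩ with hBf
  -- frame facts for hole `i`
  have hu1 : ∀ t, 1 ≤ frameVel (Λt i t) 0 := fun t ↦ by
    have h := one_le_abs_lorentz_apply_zero (Λt i t)
    rw [abs_of_pos (hpos i t)] at h
    exact h
  have hmono : Monotone T₀ :=
    (strictMono_of_deriv_pos fun x ↦ by rw [(hclock x).deriv]; linarith [hu1 (T₀ x)]).monotone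
  have hγ0 : 0 ≤ γ := zero_le_one.trans hγ1
  -- slab geometry and constants
  set R' : ℝ := max R 0 + |a i| with hR'
  have hR'0 : 0 ≤ R' := add_nonneg (le_max_right _ _) (abs_nonneg _)
  set ρ : ℝ := 1 + R' with hρ
  have hρ1 : 1 ≤ ρ := by rw [hρ]; linarith
  set D : ℝ := 640 * γ ^ 4 * ρ ^ 4 with hD
  set G : ℝ := 6000 * γ ^ 5 * ρ ^ 6 with hG
  have hDpos : 0 < D := by positivity
  have hGpos : 0 < G := by positivity
  set P : ℝ := 4 * γ + (4 * γ) ^ 2 with hP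
  obtain ⟨CK, hCK0, hCKb⟩ := exists_bound_iteratedFDeriv_kerr (M i) (a i) hrPlus
  -- epsilons
  rw [ENNReal.tendsto_nhds_zero]
  intro ε' hε'
  rcases eq_or_ne ε' ⊤ with htop | htop
  · exact Eventually.of_forall fun _ ↦ htop ▸ le_top
  set e : ℝ := ε'.toReal with he
  have he0 : 0 < e := ENNReal.toReal_pos hε'.ne' htop
  set η₁ : ℝ := e / (3 * (32 * D ^ 4)) with hη₁
  have hη₁0 : 0 < η₁ := by positivity
  set η₂ : ℝ := e / (3 * (32 * D ^ 4) * (N + 1)) with hη₂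
  have hη₂0 : 0 < η₂ := by positivity
  set δ : ℝ := min (min 1 (1 / G)) (e / (3 * (30 * (CK + 1) * G))) with hδ
  have hδ0 : 0 < δ := by positivity
  have hδ1 : δ ≤ 1 := (min_le_left _ _).trans (min_le_left _ _)
  have hGδ : G * δ ≤ 1 := by
    have h : δ ≤ 1 / G := (min_le_left _ _).trans (min_le_right _ _)
    calc G * δ ≤ G * (1 / G) := mul_le_mul_of_nonneg_left h hGpos.le
      _ = 1 := mul_one_div_cancel hGpos.ne'
  have h30 : 30 * CK * (G * δ) ≤ e / 3 := by
    have h : δ ≤ e / (3 * (30 * (CK + 1) * G)) := min_le_right _ _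
    have h1 : 30 * CK * (G * δ) ≤ 30 * (CK + 1) * G * δ := by nlinarith [hGpos.le, hδ0.le]
    have h2 : 30 * (CK + 1) * G * δ ≤ 30 * (CK + 1) * G * (e / (3 * (30 * (CK + 1) * G))) :=
      mul_le_mul_of_nonneg_left h (by positivity)
    have h3 : 30 * (CK + 1) * G * (e / (3 * (30 * (CK + 1) * G))) = e / 3 := by
      field_simp
    linarith
  have h32 : 32 * D ^ 4 * η₁ = e / 3 := by rw [hη₁]; field_simp
  have hN32 : (N : ℝ) * (32 * D ^ 4 * η₂) ≤ e / 3 := by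
    have h1 : (N : ℝ) * (32 * D ^ 4 * η₂) = e / 3 * (N / (N + 1)) := by rw [hη₂]; field_simp
    have h2 : (N : ℝ) / (N + 1) ≤ 1 := by
      rw [div_le_one (by positivity)]; linarith
    rw [h1]
    calc e / 3 * (N / (N + 1)) ≤ e / 3 * 1 := mul_le_mul_of_nonneg_left h2 (by positivity)
      _ = e / 3 := mul_one _
  -- the `δ`-window of hole `i`
  obtain ⟨S, hu', hu'', hL', hL'', hL''', hP', hP'', hP''', hc', hc'', hc''', hF', hF''⟩ :=
    exists_window (Λt i) (ξ i) (hΛt i) (hdec i) (huγ i) (hpos i) (hξ i) (hmis i) hδ0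
  -- the lab deviation
  obtain ⟨S₁, hS₁⟩ := eventually_atTop.mp (ENNReal.tendsto_nhds_zero.mp hdev _ (ENNReal.ofReal_pos.mpr hη₁0))
  -- the other holes
  have hoth' : ∀ᶠ t in atTop, ∀ j, j ≠ i → ∀ x : E4, x 0 = t → ‖E4.spatial x - ξ i t‖ ≤ P * R' →
      0 < Kerr.radius (a j) (poincareInv (Λt j t) (E4.ofTimeSpace t (ξ j t)) x) ∧
      ∀ l ≤ 2, ‖iteratedFDeriv ℝ l (fun z : E4 ↦ boostedKerrBilin (Λt j (z 0))
        (E4.ofTimeSpace (z 0) (ξ j (z 0))) (M j) (a j) z - Minkowski.bilin) x‖ ≤ η₂ := by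
    refine eventually_all.mpr fun j ↦ ?_
    by_cases hj : j = i
    · exact Eventually.of_forall fun t h ↦ (h hj).elim
    · exact (eventually_otherHole_small i j M a ξ Λt (hΛt j) (hdec j) hγ1 (huγ j) (hpos j) (hξ j) (hmis j)
        (hsep j hj) (P * R') hη₂0).mono fun t ht _ ↦ ht
  obtain ⟨S₂, hS₂⟩ := eventually_atTop.mp hoth'
  set S' : ℝ := max S (max S₁ S₂) with hS'
  -- lateness in the model time
  have hlate : ∀ᶠ τ in atTop, S' + 4 * γ * R' ≤ T₀ (τ - 1) := by
    have h := hT₀inf.comp (tendsto_atTop_add_const_right atTop (-1) tendsto_id)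
    filter_upwards [h.eventually (eventually_ge_atTop (S' + 4 * γ * R'))] with τ hτ
    simpa [sub_eq_add_neg] using hτ
  obtain ⟨τh, hτh'⟩ := hhon R'
  filter_upwards [hlate, eventually_ge_atTop τh] with τ hτ hτh
  -- bound the truncated deviation on the slab `τ`
  unfold Spacetime.truncDeviationCk supCkENorm
  refine iSup₂_le fun m hm ↦ iSup₂_le fun x hx ↦ ?_
  obtain ⟨y', hy', rfl⟩ := hx
  have hyK : y'.1 ∈ boostedKerrExterior 1 0 (M i) (a i) := y'.2
  have hy : y'.1 ∈ Kerr.exterior (M i) (a i) := by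
    have h := hyK
    rw [mem_boostedKerrExterior, poincareInv_one, sub_zero] at h
    exact h
  rw [ModelBackground.mem_truncTimeSlab] at hy'
  have hy0 : y'.1 0 = τ := by
    have h := hy'.1
    change (poincareInv 1 0 y'.1) 0 = τ at h
    rwa [poincareInv_one, sub_zero] at h
  have hyR : Kerr.radius (a i) y'.1 ≤ R := by
    have h := hy'.2
    change Kerr.radius (a i) (poincareInv 1 0 y'.1) ≤ R at h
    rwa [poincareInv_one, sub_zero] at h
  have hyR' : ‖E4.spatial y'.1‖ ≤ R' := norm_spatial_le_of_radius_le (a i) y'.1 hyR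
  have hAeq := hτh' y'.1 (by rw [hy0]; exact hτh) hyR'
  -- the lab time of the chart point
  set T : ℝ := clockMap (Λt i) T₀ y'.1 with hTdef
  have hSle : S' ≤ T := by
    have h := abs_clockMap_sub_le (Λt i) T₀ (huγ i) y'.1
    rw [hy0] at h
    have h1 : 4 * γ * ‖E4.spatial y'.1‖ ≤ 4 * γ * R' := mul_le_mul_of_nonneg_left hyR' (by positivity)
    have h2 : T₀ (τ - 1) ≤ T₀ τ := hmono (by linarith)
    have h3 := neg_abs_le (clockMap (Λt i) T₀ y'.1 - T₀ τ)
    linarith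
  have hS_T : S ≤ T := (le_max_left _ _).trans hSle
  have hS₁_T : S₁ ≤ T := ((le_max_left _ _).trans (le_max_right _ _)).trans hSle
  have hS₂_T : S₂ ≤ T := ((le_max_right _ _).trans (le_max_right _ _)).trans hSle
  have hSwin : S + 4 * γ * R' ≤ T₀ (τ - 1) := by
    have h : S ≤ S' := le_max_left _ _
    linarith
  -- the chart point and its properties
  set z : E4 := honestChart (Λt i) (ξ i) T₀ y'.1 with hz
  have hz0 : z 0 = T := honestChart_apply_zero (Λt i) (ξ i) T₀ y'.1
  have hzU : z ∈ U := by
    have h := hAU y'.1 hyK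
    rwa [hAeq.eq_of_nhds] at h
  have hoff : ‖E4.spatial z - ξ i T‖ ≤ P * R' := by
    rw [hz, spatial_honestChart, ← hTdef, add_sub_cancel_left]
    have h1 : ‖E4.spatial (purgedFrame (Λt i T) (E4.spatial y'.1))‖ ≤ ‖purgedFrame (Λt i T) (E4.spatial y'.1)‖ :=
      (E4.spatial.le_opNorm _).trans
        ((mul_le_mul_of_nonneg_right norm_spatialCLM_le (norm_nonneg _)).trans (by rw [one_mul]))
    have h2 : ‖purgedFrame (Λt i T) (E4.spatial y'.1)‖ ≤ P * R' := by
      refine ((purgedFrame (Λt i T)).le_opNorm _).trans ?_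
      have h3 : ‖purgedFrame (Λt i T)‖ ≤ P := by
        refine (norm_purgedFrame_le _).trans ?_
        have h4 := norm_frame_le_four_mul (Λt i) (huγ i) T
        have h5 : ‖((Λt i T : E4 ≃L[ℝ] E4) : E4 →L[ℝ] E4)‖ ^ 2 ≤ (4 * γ) ^ 2 :=
          pow_le_pow_left₀ (norm_nonneg _) h4 2
        rw [hP]; linarith
      exact mul_le_mul h3 hyR' (norm_nonneg _) (by rw [hP]; positivity)
    exact h1.trans h2
  -- the other holes at the chart point
  have hoth : ∀ j ≠ i, 0 < Kerr.radius (a j) (poincareInv (Λ j (z 0))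
      (E4.ofTimeSpace (z 0) (ξ j (z 0))) z) ∧ ∀ l ≤ 2, ‖iteratedFDeriv ℝ l (H j) z‖ ≤ η₂ := by
    intro j hj
    obtain ⟨h1, h2⟩ := hS₂ T hS₂_T j hj z hz0 hoff
    refine ⟨?_, fun l hl ↦ ?_⟩
    · rw [hz0, ← hrad j]; exact h1
    · have hfun : H j = fun w : E4 ↦ boostedKerrBilin (Λt j (w 0)) (E4.ofTimeSpace (w 0) (ξ j (w 0)))
          (M j) (a j) w - Minkowski.bilin := funext fun w ↦ by rw [hH, hbil]
      rw [hfun]; exact h2 l hl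
  -- the lab deviation at the chart point
  have hdevb : ∀ l ≤ 2, ‖iteratedFDeriv ℝ l (𝓢.deviationExtend Bf Φ) z‖ ≤ η₁ := by
    intro l hl
    have hmem : z ∈ Subtype.val '' Bf.timeSlab (z 0) := ⟨⟨z, hzU⟩, rfl, rfl⟩
    have h1 := enorm_iteratedFDeriv_le_supCkENorm (k := 3) (by omega : l ≤ 3) hmem (𝓢.deviationExtend Bf Φ)
    have h2 : 𝓢.deviationCk Bf Φ 3 (z 0) ≤ ENNReal.ofReal η₁ := hS₁ (z 0) (by rw [hz0]; exact hS₁_T)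
    have h3 : ‖iteratedFDeriv ℝ l (𝓢.deviationExtend Bf Φ) z‖ₑ ≤ ENNReal.ofReal η₁ := h1.trans h2
    rwa [← ofReal_norm, ENNReal.ofReal_le_ofReal_iff hη₁0.le] at h3
  -- the Kerr bounds at `y`
  have hCK : ∀ j ≤ 2, ‖iteratedFDeriv ℝ j (Kerr.bilin (M i) (a i)) y'.1‖ ≤ CK :=
    hCKb y'.1 ((le_max_left _ _).trans_lt (Kerr.mem_exterior.mp hy)).le
  -- the slab-point bound
  have hGδ' : 6000 * γ ^ 5 * (1 + R') ^ 6 * δ ≤ 1 := by rw [← hρ]; exact hGδ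
  have hb := norm_iteratedFDeriv_deviation_slabPoint_le 𝓢 i M a Λ ξ (Λt i) T₀ (hbil i) (hrad i) hH hBb hΛ hξ
    (hΛt i) hT₀ hclock hγ1 hu1 (huγ i) hδ0.le hδ1 hu' hu'' hL' hL'' hL''' hP' hP'' hP''' hc' hc'' hc''' hF' hF''
    U Φ hΦ hAc hAU hΨ₁ hR'0 hSwin hGδ' hy hy0 hyR' hAeq hCK hη₁0.le hη₂0.le hoth hzU hdevb m hm
  rw [← hρ, ← hD, ← hG] at hb
  have hfin : ‖iteratedFDeriv ℝ m (𝓢.deviationExtend (boostedKerrBackground 1 0 (M i) (a i)) Ψ₁) y'.1‖ ≤ e := by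
    have h30' : 30 * CK * (G * δ) ≤ e / 3 := h30
    linarith
  calc ‖iteratedFDeriv ℝ m (𝓢.deviationExtend (boostedKerrBackground 1 0 (M i) (a i)) Ψ₁) y'.1‖ₑ
      = ENNReal.ofReal ‖iteratedFDeriv ℝ m (𝓢.deviationExtend (boostedKerrBackground 1 0 (M i) (a i)) Ψ₁) y'.1‖ :=
        (ofReal_norm _).symm
    _ ≤ ENNReal.ofReal e := ENNReal.ofReal_le_ofReal hfin
    _ = ε' := ENNReal.ofReal_toReal htop

/-- Registered one-line form (worker carrier `rechart_norm_spatial_le_of_radius_le`). [folklore] -/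
theorem rechart_norm_spatial_le_of_radius_le : open Literature.Geometry.Lorentzian in ∀ (a : ℝ) {R : ℝ} (y : E4), Kerr.radius a y ≤ R → ‖E4.spatial y‖ ≤ max R 0 + |a| := fun a _ y h ↦ norm_spatial_le_of_radius_le a y h

end Summit.FinalStateConjecture.FinalStateConjecture.Theorems.SublinearIsFree.Rechart

end
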